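import Summits.Schanuel.Schanuel.Theorems.DiophantineDichotomyApproximationPropertyPointDatumOfClause

/-!
# Stub `pointDatum_of_closeZero` of line `orbit-interpolation-determinant` (stmt-Schanuel-6117)

Route `DiophantineDichotomy`, crux
`Summit.Schanuel.Schanuel.Theses.DiophantineDichotomy.ApproximationProperty` (stmt-Schanuel-6117),
line `orbit-interpolation-determinant` (skeleton v24), registered stub `pointDatum_of_closeZero`
(vocabulary in `Theorems/DiophantineDichotomyApproximationPropertyDefs.lean`).

This is the PACKAGING half of the landed per-scale good-orbit transfer
`PointDatum.pointDatum_of_clause_main` (`Theorems/…PointDatumOfClause.lean`), isolated from the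
transfer `C⁺`: assuming only `ZeroDimDictionary`, for `ω ∈ ℂᵗ`, `c₁ ≥ 1`, a boost `λ ≥ 1` and a
real `M > 0` there is `c ≥ c₁` (namely `c = c₁ + (c₁λ + c_d c₁ᵗ) + 4M(c_d + 1) + 4M log(2Θ²)`,
`Θ = ‖(1:ω)‖`, `c_d` the dictionary constant) such that for `Y ≥ Δ ≥ c` and a homogeneous PRIME
`𝔭 ⊂ ℚ[x₀, …, x_t]` of rank `1` with `deg 𝔭 ≤ (c₁Δ)ᵗ`, `h(𝔭) ≤ c₁λYΔᵗ⁻¹` and SOME projective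
zero `z` of `𝔭` within projective distance `exp(−(Δ h(𝔭) + Y deg 𝔭)/(2M))` of `(1:ω)`, there
are a number field `K`, `β ∈ Kᵗ` and `σ : K →+* ℂ` with `[K:ℚ] ≤ (cΔ)ᵗ`, `h_K(1:β) ≤ cYΔᵗ⁻¹`
and `‖σ(β) − ω‖ ≤ exp(−(Δ h_K(1:β) + Y[K:ℚ])/c)` (a `PointAPAbsAt t`-datum at `(Δ, Y)`).

Proof: verbatim the second half of `PointDatum.pointDatum_of_clause_main` — `deg 𝔭 ≥ 1`
(Prop. 4.4, `Literature.Barriers.Schanuel.one_le_ideg_of_isPrime`) gives `X ≥ c`,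
`PointDatum.accuracy_le` turns the projective distance into `≤ 1/2` after the factor `Θ`,
`PhilipponMain.affine_near_of_projDist_le` puts the zero in the chart `z₀ ≠ 0`, the dictionary
(A), (B), (C) gives `K = ℚ(b)`, the affine point `(b₁/b₀, …, b_t/b₀)`, the embedding, and
`PointDatum.height_budget_le` / `PointDatum.accuracy_le` give the budgets. Sources:
NesterenkoPhilippon2001 (LNM 1752) Ch. 3 §4 (Prop. 4.4, p. 38), Ch. 4 §4 (p. 61); Philippon 1986
(Publ. Math. IHÉS 64) §3.
-/

set_option linter.dupNamespace false

noncomputable section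

attribute [local instance] MvPolynomial.gradedAlgebra

namespace Summit.Schanuel.Schanuel.Cruxes.ApproximationProperty.OrbitInterpolationDeterminant

open Literature.NumberTheory.Transcendental Literature.NumberTheory.Transcendental.Nesterenko
  Literature.NumberTheory.Transcendental.PhilipponMain MvPolynomial Real

namespace PointDatum

/-- **The packaging step (curried form of the stub `pointDatum_of_closeZero`).** For `ω ∈ ℂᵗ`,
`c₁ ≥ 1`, `λ ≥ 1`, `M > 0`: with `c_d` the dictionary constant, `Θ = ‖(1:ω)‖` and
`c = c₁ + (c₁λ + c_d c₁ᵗ) + 4M(c_d+1) + 4M log(2Θ²)`, a homogeneous prime `𝔭` of rank `1` with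
`deg 𝔭 ≤ (c₁Δ)ᵗ`, `h(𝔭) ≤ c₁λYΔᵗ⁻¹` (`Y ≥ Δ ≥ c`) and a projective zero at distance
`≤ exp(−(Δ h(𝔭) + Y deg 𝔭)/(2M))` from `(1:ω)` yields the point `(b₁/b₀, …, b_t/b₀) ∈ Kᵗ`,
`K = ℚ(b)`, an embedding and the three budgets.
[cite: NesterenkoPhilippon2001, Ch. 3 Prop. 4.4 (p. 38); Ch. 4 §4 (p. 61)] -/
theorem pointDatum_of_closeZero_main (t : ℕ) (ht : 1 ≤ t) (hdict : ZeroDimDictionary)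
    (ω : Fin t → ℂ) (c₁ lam M : ℝ) (hc₁ : 1 ≤ c₁) (hlam1 : 1 ≤ lam) (hM : 0 < M) :
    ∃ c : ℝ, c₁ ≤ c ∧ ∀ Δ Y : ℝ, c ≤ Δ → Δ ≤ Y →
      ∀ 𝔭 : Ideal (Rx t), 𝔭.IsPrime → 𝔭.IsHomogeneous (homogeneousSubmodule (Fin (t + 1)) ℚ) →
        IsUnmixedOfRank 𝔭 1 → (ideg 𝔭 1 : ℝ) ≤ (c₁ * Δ) ^ t →
        iheight 𝔭 1 ≤ c₁ * (lam * Y) * Δ ^ (t - 1) →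
        ∀ z ∈ projZeros 𝔭, projDist (Fin.cons 1 ω) z ≤
          Real.exp (-((Δ * iheight 𝔭 1 + Y * ideg 𝔭 1) / (2 * M))) →
        ∃ (K : Type) (_ : Field K) (_ : NumberField K) (β : Fin t → K) (σ : K →+* ℂ),
          (Module.finrank ℚ K : ℝ) ≤ (c * Δ) ^ t ∧
          Height.logHeight (Fin.cons (1 : K) β : Fin (t + 1) → K) ≤ c * Y * Δ ^ (t - 1) ∧
          ‖(fun j => σ (β j)) - ω‖ ≤
            Real.exp (-((Δ * Height.logHeight (Fin.cons (1 : K) β : Fin (t + 1) → K) +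
              Y * Module.finrank ℚ K) / c)) := by
  classical
  -- constants attached to `t`, `ω`, `c₁`, `λ`, `M`
  obtain ⟨cd, hcd, hdict⟩ := hdict t ht
  have hc₁0 : 0 < c₁ := lt_of_lt_of_le one_pos hc₁
  set ω₁ : Fin (t + 1) → ℂ := Fin.cons 1 ω with hω₁def
  set Θ : ℝ := ‖ω₁‖ with hΘdef
  have hΘ : 1 ≤ Θ := one_le_norm_cons_one ω
  have hlam0 : 0 ≤ lam := le_trans zero_le_one hlam1
  have hlog0 : 0 ≤ Real.log (2 * Θ ^ 2) := Real.log_nonneg (by nlinarith)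
  -- the constant of the datum at `ω`
  set c : ℝ := c₁ + (c₁ * lam + cd * c₁ ^ t) + 4 * M * (cd + 1) + 4 * M * Real.log (2 * Θ ^ 2)
    with hcdef
  have n2 : 0 ≤ c₁ * lam + cd * c₁ ^ t := by positivity
  have n3 : 0 ≤ 4 * M * (cd + 1) := by positivity
  have n4 : 0 ≤ 4 * M * Real.log (2 * Θ ^ 2) := by positivity
  have hc_h : c₁ * lam + cd * c₁ ^ t ≤ c := by linarith
  have hc_a1 : 4 * M * (cd + 1) ≤ c := by linarith
  have hc_a2 : 4 * M * Real.log (2 * Θ ^ 2) ≤ c := by linarith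
  have hcc₁ : c₁ ≤ c := by linarith
  have hc1 : 1 ≤ c := hc₁.trans hcc₁
  have hc0 : 0 < c := lt_of_lt_of_le one_pos hc1
  refine ⟨c, hcc₁, fun Δ Y hΔ hY 𝔭 h𝔭prime h𝔭hom h𝔭unm hdeg hh𝔭 β hβ hρM => ?_⟩
  have hΔ1 : 1 ≤ Δ := hc1.trans hΔ
  have hΔ0 : 0 ≤ Δ := by linarith
  have hY0 : 0 ≤ Y := by linarith
  have hh𝔭0 : 0 ≤ iheight 𝔭 1 := height_nonneg _
  have hD1 : (1 : ℝ) ≤ ideg 𝔭 1 := by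
    exact_mod_cast Literature.Barriers.Schanuel.one_le_ideg_of_isPrime
      NesterenkoPhilippon2001_ch3_prop_4_4_holds le_rfl ht h𝔭prime h𝔭hom h𝔭unm
  set ρ : ℝ := projDist ω₁ β with hρdef
  have hρ0 : 0 ≤ ρ := projDist_nonneg _ _
  set X : ℝ := Δ * iheight 𝔭 1 + Y * ideg 𝔭 1 with hXdef
  have hXc : c ≤ X := by
    have e1 : Y ≤ Y * ideg 𝔭 1 := le_mul_of_one_le_right hY0 hD1
    have e2 : 0 ≤ Δ * iheight 𝔭 1 := by positivity
    linarith
  obtain ⟨hacc, hhalf⟩ := accuracy_le hΘ hM hcd.le hc_a1 hc_a2 hXc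
  -- the close zero is affine-near
  obtain ⟨hβ0, -, hnear⟩ :=
    affine_near_of_projDist_le ω hβ.1 ((mul_le_mul_of_nonneg_right hρM (by positivity)).trans hhalf)
  -- the dictionary: `β = l · σ(b)`, `K = ℚ(b)`, output point `b' = (b₁/b₀, …, b_t/b₀)`
  obtain ⟨K, _instF, _instNF, b, -, hzeros, -, hfin, hhb, -, -⟩ := hdict 𝔭 h𝔭prime h𝔭hom h𝔭unm
  obtain ⟨-, σ, l, hβeq⟩ := (hzeros β).mp hβ
  have hβ0' : β 0 = l * σ (b 0) := by rw [hβeq]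
  have hl : l ≠ 0 := fun h => hβ0 (by rw [hβ0', h, zero_mul])
  have hb00 : b 0 ≠ 0 := fun h => hβ0 (by rw [hβ0', h, map_zero, mul_zero])
  set b' : Fin t → K := fun j => b j.succ / b 0 with hb'def
  have hσb' : ∀ j : Fin t, σ (b' j) = β j.succ / β 0 := by
    intro j
    have e1 : β j.succ = l * σ (b j.succ) := by rw [hβeq]
    rw [hb'def, map_div₀, e1, hβ0', mul_div_mul_left _ _ hl]
  have hcons : (Fin.cons (1 : K) b' : Fin (t + 1) → K) = (b 0)⁻¹ • b := by
    funext i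
    refine Fin.cases ?_ (fun j => ?_) i
    · simp [hb00]
    · simp [hb'def, div_eq_inv_mul]
  have hheight : Height.logHeight (Fin.cons (1 : K) b' : Fin (t + 1) → K) = Height.logHeight b := by
    rw [hcons, Height.logHeight_smul_eq_logHeight _ (inv_ne_zero hb00)]
  have hfinR : (Module.finrank ℚ K : ℝ) = ideg 𝔭 1 := by exact_mod_cast hfin
  refine ⟨K, _instF, _instNF, b', σ, ?_, ?_, ?_⟩
  · -- degree budget
    rw [hfinR]
    exact hdeg.trans (pow_le_pow_left₀ (by positivity) (mul_le_mul_of_nonneg_right hcc₁ hΔ0) t)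
  · -- height budget
    rw [hheight]
    exact height_budget_le ht hc₁ hcd.le hΔ1 hY hhb hh𝔭 hdeg hc_h
  · -- accuracy
    rw [hheight, hfinR]
    have hsup : ‖(fun j => σ (b' j)) - ω‖ ≤ 2 * Θ ^ 2 * ρ := by
      refine (pi_norm_le_iff_of_nonneg (by positivity)).mpr fun j => ?_
      simp only [Pi.sub_apply, hσb']
      exact hnear j
    have hnum : Δ * Height.logHeight b + Y * ideg 𝔭 1 ≤ (cd + 1) * X := by
      have e1 : Δ * Height.logHeight b ≤ Δ * (iheight 𝔭 1 + cd * ideg 𝔭 1) :=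
        mul_le_mul_of_nonneg_left hhb hΔ0
      have e2 : Δ * (cd * ideg 𝔭 1) ≤ Y * (cd * ideg 𝔭 1) :=
        mul_le_mul_of_nonneg_right hY (by positivity)
      have e3 : 0 ≤ cd * (Δ * iheight 𝔭 1) := by positivity
      rw [hXdef]
      linarith
    calc ‖(fun j => σ (b' j)) - ω‖ ≤ 2 * Θ ^ 2 * ρ := hsup
      _ ≤ 2 * Θ ^ 2 * Real.exp (-(X / (2 * M))) := mul_le_mul_of_nonneg_left hρM (by positivity)
      _ ≤ Real.exp (-((cd + 1) * X / c)) := hacc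
      _ ≤ Real.exp (-((Δ * Height.logHeight b + Y * ideg 𝔭 1) / c)) := by
          rw [exp_le_exp, neg_le_neg_iff]
          exact div_le_div_of_nonneg_right hnum hc0.le

end PointDatum

/-- **Stub `pointDatum_of_closeZero` — the packaging half of the per-scale good-orbit transfer
(any `t ≥ 1`): `ZeroDimDictionary →` for every `ω ∈ ℂᵗ`, `c₁ ≥ 1`, boost `λ ≥ 1` and `M > 0`
there is `c ≥ c₁` such that for `Y ≥ Δ ≥ c`, a homogeneous prime `𝔭` of rank `1` with
`deg 𝔭 ≤ (c₁Δ)ᵗ`, `h(𝔭) ≤ c₁λYΔᵗ⁻¹` and SOME projective zero within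
`exp(−(Δ h(𝔭) + Y deg 𝔭)/(2M))` of `(1:ω)` yields a `PointAPAbsAt t`-datum at `(Δ, Y)` with
constant `c`.** Short wrapper around `PointDatum.pointDatum_of_closeZero_main`
(projective-to-affine chart, 0-dimensional dictionary, budgets).
[cite: NesterenkoPhilippon2001, Ch. 3 Prop. 4.4 (p. 38); Ch. 4 §4 (p. 61)] -/
theorem pointDatum_of_closeZero : ∀ t : ℕ, 1 ≤ t → ZeroDimDictionary → ∀ (ω : Fin t → ℂ) (c₁ lam M : ℝ), 1 ≤ c₁ → 1 ≤ lam → 0 < M → ∃ c : ℝ, c₁ ≤ c ∧ ∀ Δ Y : ℝ, c ≤ Δ → Δ ≤ Y → ∀ 𝔭 : Ideal (Rx t), 𝔭.IsPrime → 𝔭.IsHomogeneous (homogeneousSubmodule (Fin (t + 1)) ℚ) → IsUnmixedOfRank 𝔭 1 → (ideg 𝔭 1 : ℝ) ≤ (c₁ * Δ) ^ t → iheight 𝔭 1 ≤ c₁ * (lam * Y) * Δ ^ (t - 1) → ∀ z ∈ projZeros 𝔭, projDist (Fin.cons 1 ω) z ≤ Real.exp (-((Δ * iheight 𝔭 1 +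 Y * ideg 𝔭 1) / (2 * M))) → ∃ (K : Type) (_ : Field K) (_ : NumberField K) (β : Fin t → K) (σ : K →+* ℂ), (Module.finrank ℚ K : ℝ) ≤ (c * Δ) ^ t ∧ Height.logHeight (Fin.cons (1 : K) β : Fin (t + 1) → K) ≤ c * Y * Δ ^ (t - 1) ∧ ‖(fun j => σ (β j)) - ω‖ ≤ Real.exp (-((Δ * Height.logHeight (Fin.cons (1 : K) β : Fin (t + 1) → K) + Y * Module.finrank ℚ K) / c)) := by
  intro t ht hdict ω c₁ lam M hc₁ hlam hM
  exact PointDatum.pointDatum_of_closeZero_main t ht hdict ω c₁ lam M hc₁ hlam hM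

end Summit.Schanuel.Schanuel.Cruxes.ApproximationProperty.OrbitInterpolationDeterminant

end
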